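/-
Origin: expansion seat `planner-pub-hodgecm-mc-axioms-1-g14-0`, handover #W145 2026-08-20T15:53:55Z md5 2dd207a6ccb8 (PKG bc6ed7442e78 → 2dd207a6ccb8; 112 l.; MECHANICAL (iib-R) rewrite v3.1 of the PKG file as it stands (94 token edits; rules R1x1+RX[h₂]x93)) (`HOME/mc/pub-hodgecm-mc-axioms-1-g14/revendor/kit-r55/stage55/HodgeCM/Model/E2InstanceR19AKE.lean`, md5 2dd207a6ccb8, 112 lines);
landed by the gen-22 packager (p-g22) in gate run 55 REPLACES the earlier landed copy of `HodgeCM/Model/E2InstanceR19AKE.lean` (seat copy carried the packager Origin header of an earlier run (stripped)).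
-/
/-
Origin: CONSTRUCTION seat `planner-pub-hodgecm-mc-axioms-3-g11-0` (unit pub-hodgecm-mc-axioms-3-g11, gen 11 of mc-axioms-3,
universe / instance-assembly lane), 2026-08-20.  RUN-40 COURTESY ROW (carver model1-g10 type note 2026-08-20T03:31:41Z STATUS
l.12433: «the K-universe instance is ONE application … neither a binder nor a discharge»).  NEW additive leaf
`HodgeCM/Model/E2InstanceR19AKE.lean`, GENERATED MECHANICALLY (`mc/pub-hodgecm-mc-axioms-3-g11/scratch/r40/mk_R19AKE.py`) from the
INSTALLED E term of record `HodgeCM/Model/E2InstanceR19AE.lean` (gate RUN 38 #362, installed/landed md5 b1da5adc6670):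
the 15 binders `h hA W S μ hR hsmall C hT hpd hk gen12 real34 hyp12 hyp34` keep their names and order, and their TYPES are
byte-identical except that the universe witnesses `hHD` / `hI` (section hypotheses of the general theorem) are replaced by the
package KERNEL theorems `Model.hHD_holds` / `Model.hI_holds` of `Model/UniverseKernel.lean` (period-1 #1095, PACKET 3K, landed RUN 38;
re-exports of the V-betti twins `exists_isReal_hodgeModel_holds` / `hodgePQ_independent_of_hodgeModel_holds`) — 164 + 164 textual
occurrences; the conclusion is stated over `Model.picardCMUniverseK h₁ h₃'` (`abbrev` := `picardCMUniverse hHD_holds hI_holds h₁ h₃'`,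
`UniverseKernel.lean`), `h₃' := cmAbelianVarietyRealised_of_eigenbasis hHD_holds hI_holds h₃` (record (iii)♭, CONVERSE GUARD kept:
`h₃ : CMAbelianVarietyEigenbasisRealised` stays a hypothesis).  Same pattern as the installed `E2InstanceR16AKE.lean` (axioms-3-g7, RUN 38).
Proof = ONE application of `perL_picardCM_r19AE hHD_holds hI_holds h₁ h₃`.  Imports: the two INSTALLED modules only.
Leaf: nothing imports it; drop alone on red.  KERNEL only: 1 theorem, 0 defs, no proof holes, no cite records, no new binder,
no discharge (BINDER-OWNERS 15 unchanged; MODEL-N ±0).  Expected `#print axioms` = {propext, Classical.choice, Quot.sound}.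
-/
import Summits.HodgeConjecture.HodgeCM.Model.E2InstanceR19AE
import Summits.HodgeConjecture.HodgeCM.Model.UniverseKernel

/-!
# E2 instance, revision 19AKE — the E term of record on the KERNEL-instantiated model universe

`Model.perL_picardCM_r19AE hHD hI h₁ h₃ …` (gate RUN 38, the general theorem of record, 15 binders) takes the two
Hodge-theoretic universe rows `hHD : exists_isReal_hodgeModel` (R-HD) and `hI : hodgePQ_independent_of_hodgeModel` (R-I) as
section hypotheses.  Both are theorems of the package since RUN 38 (`Model.hHD_holds`, `Model.hI_holds`, `Model/UniverseKernel.lean`),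
so the END-STATE reading over the three cited records (ii-a) `BallQuotientUniformised`, (ii-b) `SpecialCyclesAlgebraic`,
(iii)♭ `CMAbelianVarietyEigenbasisRealised` alone is the one-line specialisation below:

* `Model.perL_picardCMK_r19AE h₁ h₃ h hA W S μ hR hsmall C hT hpd hk gen12 real34 hyp12 hyp34 :
    (picardCMUniverseK h₁ (cmAbelianVarietyRealised_of_eigenbasis hHD_holds hI_holds h₃)).PerL`.

Bounce-isolated: if this file is not installed, `Model.perL_picardCM_r19AE` stands unchanged.
-/

noncomputable section

open scoped TensorProduct InnerProductSpace Matrix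

namespace HodgeCM

namespace Model

open HodgeCM.Universe (AdelicThetaCore AdelicThetaCore₀ SideData ThetaModel ModelAxiomsPerL)
open Literature.AlgebraicGeometry.HodgeTheory
open Literature.AlgebraicGeometry.ComplexMultiplication (Shimura1998_Thm3_isogenousPower Shimura1998_Thm2_Cor)
open Literature.NumberTheory.Automorphic.PicardCM
open Literature.NumberTheory.Transcendental (Arapura2012_Cor_15_4_6)
open HodgeCM.CMTypeOps (inflate)
open HodgeCM.Model.SupplyResidual (ClassSupplyPackN)
open HodgeCM.Model.ThetaSpace

variable (h₁ : BallQuotientUniformised)  (h₃ : CMAbelianVarietyEigenbasisRealised)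

/-- **E2 instance, revision 19AKE — `Model.perL_picardCM_r19AE` on the kernel-instantiated universe `picardCMUniverseK`.**
The 15 binders of the E term of record VERBATIM with `hHD := Model.hHD_holds`, `hI := Model.hI_holds` substituted in their
types; `h₃ : CMAbelianVarietyEigenbasisRealised` (record (iii)♭) bridged by `cmAbelianVarietyRealised_of_eigenbasis`.
Proof: one application of `perL_picardCM_r19AE`. -/
theorem perL_picardCMK_r19AE (h : Bool)
    (hA : Arapura2012_Cor_15_4_6)
    (W : ∀ {L : CMField} {ι₁ : L →+* ℂ} (V : HermSpace3 L ι₁) (c : SeesawCtx L), WmInput V c.D)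
    (S : ∀ {L : CMField} {ι₁ : L →+* ℂ} (V : HermSpace3 L ι₁) (c : SeesawCtx L), ThetaAdelicSide V c)
    (μ : ∀ {L : CMField}, SeesawCtx L → Fin 4 → NumberField.InfinitePlace L → ℤ)
    (hR : DeligneMilne1982_Thm_6_20_full)
    (hsmall : ∀ {L : CMField} {ι₁ : L →+* ℂ} (V : HermSpace3 L ι₁) (c : SeesawCtx L),
      (thetaModelOf hHD_holds hI_holds h₁ (cmAbelianVarietyRealised_of_eigenbasis hHD_holds hI_holds h₃) h (embOf hHD_holds hI_holds h₁ (cmAbelianVarietyRealised_of_eigenbasis hHD_holds hI_holds h₃)) (coverOf hHD_holds hI_holds h₁ (cmAbelianVarietyRealised_of_eigenbasis hHD_holds hI_holds h₃) hA) (wmOfInput W) (thetaOf _ (thetaClassInputOf _ (fun V c => thetaSpaceInputOf hHD_holds hI_holds h₁ (cmAbelianVarietyRealised_of_eigenbasis hHD_holds hI_holds h₃) S V c))) (d12Of μ) (d34Of μ)).GoodCtx ι₁ c → Module.finrank ℚ c.K = 6 →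
      ∀ i : Fin 4, ∃ Γ₀ : Level V, ∀ Γ ≤ Γ₀,
        ∃ (M : CMField) (k : c.K →+* M) (σ' : M →+* ℂ), σ'.comp k = c.σ ∧
        (thetaModelOf hHD_holds hI_holds h₁ (cmAbelianVarietyRealised_of_eigenbasis hHD_holds hI_holds h₃) h (embOf hHD_holds hI_holds h₁ (cmAbelianVarietyRealised_of_eigenbasis hHD_holds hI_holds h₃)) (coverOf hHD_holds hI_holds h₁ (cmAbelianVarietyRealised_of_eigenbasis hHD_holds hI_holds h₃) hA) (wmOfInput W) (thetaOf _ (thetaClassInputOf _ (fun V c => thetaSpaceInputOf hHD_holds hI_holds h₁ (cmAbelianVarietyRealised_of_eigenbasis hHD_holds hI_holds h₃) S V c))) (d12Of μ) (d34Of μ)).Theta V c i Γ ⊆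
          (picardCMUniverse hHD_holds hI_holds h₁ (cmAbelianVarietyRealised_of_eigenbasis hHD_holds hI_holds h₃)).Uiso Γ M (inflate k (c.Ψ i)) σ')
    (C : ∀ {L : CMField} {ι₁ : L →+* ℂ} (V : HermSpace3 L ι₁) (c : SeesawCtx L) (hV : IsAnisotropic L V.Hm),
      (thetaModelOf hHD_holds hI_holds h₁ (cmAbelianVarietyRealised_of_eigenbasis hHD_holds hI_holds h₃) h (embOf hHD_holds hI_holds h₁ (cmAbelianVarietyRealised_of_eigenbasis hHD_holds hI_holds h₃)) (coverOf hHD_holds hI_holds h₁ (cmAbelianVarietyRealised_of_eigenbasis hHD_holds hI_holds h₃) hA) (wmOfInput W) (thetaOf _ (thetaClassInputOf _ (fun V c => thetaSpaceInputOf hHD_holds hI_holds h₁ (cmAbelianVarietyRealised_of_eigenbasis hHD_holds hI_holds h₃) S V c))) (d12Of μ) (d34Of μ)).GoodCtx ι₁ c →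
      Module.finrank ℚ c.K = 6 → ∀ k : Fin 4, k = 0 ∨ k = 1 → ∀ N : ℕ, 0 < N →
        ArchKTypeData (thetaSpaceInputIn hHD_holds hI_holds h₁ (cmAbelianVarietyRealised_of_eigenbasis hHD_holds hI_holds h₃) (S V c) hV) k N)
    (hT : ∀ {L : CMField} {ι₁ : L →+* ℂ} (V : HermSpace3 L ι₁) (c : SeesawCtx L) (k : Fin 4) (N : ℕ),
      ((S V c).P k).IsThetaArchContinuous N)
    (hpd : ∀ {L : CMField} {ι₁ : L →+* ℂ} (V : HermSpace3 L ι₁) (c : SeesawCtx L) (hV : IsAnisotropic L V.Hm)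
      (hc : (thetaModelOf hHD_holds hI_holds h₁ (cmAbelianVarietyRealised_of_eigenbasis hHD_holds hI_holds h₃) h (embOf hHD_holds hI_holds h₁ (cmAbelianVarietyRealised_of_eigenbasis hHD_holds hI_holds h₃)) (coverOf hHD_holds hI_holds h₁ (cmAbelianVarietyRealised_of_eigenbasis hHD_holds hI_holds h₃) hA) (wmOfInput W) (thetaOf _ (thetaClassInputOf _ (fun V c => thetaSpaceInputOf hHD_holds hI_holds h₁ (cmAbelianVarietyRealised_of_eigenbasis hHD_holds hI_holds h₃) S V c))) (d12Of μ) (d34Of μ)).GoodCtx ι₁ c)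
      (h6 : Module.finrank ℚ c.K = 6) (k : Fin 4) (hk : k = 0 ∨ k = 1) (N : ℕ) (hN : 0 < N),
      (C V c hV hc h6 k hk N hN).IsWeaklyPDiff Literature.AlgebraicGeometry.ShimuraVarieties.BallForms.expP)
    (hk : ∀ {L : CMField} {ι₁ : L →+* ℂ} (V : HermSpace3 L ι₁) (c : SeesawCtx L) (hV : IsAnisotropic L V.Hm)
      (hc : (thetaModelOf hHD_holds hI_holds h₁ (cmAbelianVarietyRealised_of_eigenbasis hHD_holds hI_holds h₃) h (embOf hHD_holds hI_holds h₁ (cmAbelianVarietyRealised_of_eigenbasis hHD_holds hI_holds h₃)) (coverOf hHD_holds hI_holds h₁ (cmAbelianVarietyRealised_of_eigenbasis hHD_holds hI_holds h₃) hA) (wmOfInput W) (thetaOf _ (thetaClassInputOf _ (fun V c => thetaSpaceInputOf hHD_holds hI_holds h₁ (cmAbelianVarietyRealised_of_eigenbasis hHD_holds hI_holds h₃) S V c))) (d12Of μ) (d34Of μ)).GoodCtx ι₁ c)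
      (h6 : Module.finrank ℚ c.K = 6) (k : Fin 4) (hk : k = 0 ∨ k = 1) (N : ℕ) (hN : 0 < N),
      (C V c hV hc h6 k hk N hN).IsPMinusKilled Literature.AlgebraicGeometry.ShimuraVarieties.BallForms.expP)
    (gen12 : ∀ {L : CMField} {ι₁ : L →+* ℂ} (V : HermSpace3 L ι₁) (c : SeesawCtx L),
      (thetaModelOf hHD_holds hI_holds h₁ (cmAbelianVarietyRealised_of_eigenbasis hHD_holds hI_holds h₃) h (embOf hHD_holds hI_holds h₁ (cmAbelianVarietyRealised_of_eigenbasis hHD_holds hI_holds h₃)) (coverOf hHD_holds hI_holds h₁ (cmAbelianVarietyRealised_of_eigenbasis hHD_holds hI_holds h₃) hA) (wmOfInput W) (thetaOf _ (thetaClassInputOf _ (fun V c => thetaSpaceInputOf hHD_holds hI_holds h₁ (cmAbelianVarietyRealised_of_eigenbasis hHD_holds hI_holds h₃) S V c))) (d12Of μ) (d34Of μ)).GoodCtx ι₁ c → Module.finrank ℚ c.K = 6 →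
      Nonempty ((thetaModelOf hHD_holds hI_holds h₁ (cmAbelianVarietyRealised_of_eigenbasis hHD_holds hI_holds h₃) h (embOf hHD_holds hI_holds h₁ (cmAbelianVarietyRealised_of_eigenbasis hHD_holds hI_holds h₃)) (coverOf hHD_holds hI_holds h₁ (cmAbelianVarietyRealised_of_eigenbasis hHD_holds hI_holds h₃) hA) (wmOfInput W) (thetaOf _ (thetaClassInputOf _ (fun V c => thetaSpaceInputOf hHD_holds hI_holds h₁ (cmAbelianVarietyRealised_of_eigenbasis hHD_holds hI_holds h₃) S V c))) (d12Of μ) (d34Of μ)).Gen12FunBridge V c))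
    (real34 : ∀ {L : CMField} {ι₁ : L →+* ℂ} (V : HermSpace3 L ι₁) (c : SeesawCtx L),
      (thetaModelOf hHD_holds hI_holds h₁ (cmAbelianVarietyRealised_of_eigenbasis hHD_holds hI_holds h₃) h (embOf hHD_holds hI_holds h₁ (cmAbelianVarietyRealised_of_eigenbasis hHD_holds hI_holds h₃)) (coverOf hHD_holds hI_holds h₁ (cmAbelianVarietyRealised_of_eigenbasis hHD_holds hI_holds h₃) hA) (wmOfInput W) (thetaOf _ (thetaClassInputOf _ (fun V c => thetaSpaceInputOf hHD_holds hI_holds h₁ (cmAbelianVarietyRealised_of_eigenbasis hHD_holds hI_holds h₃) S V c))) (d12Of μ) (d34Of μ)).GoodCtx ι₁ c → Module.finrank ℚ c.K = 6 →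
      Nonempty ((thetaModelOf hHD_holds hI_holds h₁ (cmAbelianVarietyRealised_of_eigenbasis hHD_holds hI_holds h₃) h (embOf hHD_holds hI_holds h₁ (cmAbelianVarietyRealised_of_eigenbasis hHD_holds hI_holds h₃)) (coverOf hHD_holds hI_holds h₁ (cmAbelianVarietyRealised_of_eigenbasis hHD_holds hI_holds h₃) hA) (wmOfInput W) (thetaOf _ (thetaClassInputOf _ (fun V c => thetaSpaceInputOf hHD_holds hI_holds h₁ (cmAbelianVarietyRealised_of_eigenbasis hHD_holds hI_holds h₃) S V c))) (d12Of μ) (d34Of μ)).Real34FunBridge V c))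
    (hyp12 : ∀ {L : CMField} {ι₁ : L →+* ℂ} (V : HermSpace3 L ι₁) (c : SeesawCtx L),
      (thetaModelOf hHD_holds hI_holds h₁ (cmAbelianVarietyRealised_of_eigenbasis hHD_holds hI_holds h₃) h (embOf hHD_holds hI_holds h₁ (cmAbelianVarietyRealised_of_eigenbasis hHD_holds hI_holds h₃)) (coverOf hHD_holds hI_holds h₁ (cmAbelianVarietyRealised_of_eigenbasis hHD_holds hI_holds h₃) hA) (wmOfInput W) (thetaOf _ (thetaClassInputOf _ (fun V c => thetaSpaceInputOf hHD_holds hI_holds h₁ (cmAbelianVarietyRealised_of_eigenbasis hHD_holds hI_holds h₃) S V c))) (d12Of μ) (d34Of μ)).GoodCtx ι₁ c → Module.finrank ℚ c.K = 6 →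
      Nonempty (((coreOf _ (embOf hHD_holds hI_holds h₁ (cmAbelianVarietyRealised_of_eigenbasis hHD_holds hI_holds h₃)) (coverOf hHD_holds hI_holds h₁ (cmAbelianVarietyRealised_of_eigenbasis hHD_holds hI_holds h₃) hA) (wmOfInput W) (thetaOf _ (thetaClassInputOf _ (fun V c => thetaSpaceInputOf hHD_holds hI_holds h₁ (cmAbelianVarietyRealised_of_eigenbasis hHD_holds hI_holds h₃) S V c)))).toCore h).HypSmoothCore12
        (((coreOf _ (embOf hHD_holds hI_holds h₁ (cmAbelianVarietyRealised_of_eigenbasis hHD_holds hI_holds h₃)) (coverOf hHD_holds hI_holds h₁ (cmAbelianVarietyRealised_of_eigenbasis hHD_holds hI_holds h₃) hA) (wmOfInput W) (thetaOf _ (thetaClassInputOf _ (fun V c => thetaSpaceInputOf hHD_holds hI_holds h₁ (cmAbelianVarietyRealised_of_eigenbasis hHD_holds hI_holds h₃) S V c)))).toCore h).side12 (d12Of μ)) (((coreOf _ (embOf hHD_holds hI_holds h₁ (cmAbelianVarietyRealised_of_eigenbasis hHD_holds hI_holds h₃)) (coverOf hHD_holds hI_holds h₁ (cmAbelianVarietyRealised_of_eigenbasis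 hHD_holds hI_holds h₃) hA) (wmOfInput W) (thetaOf _ (thetaClassInputOf _ (fun V c => thetaSpaceInputOf hHD_holds hI_holds h₁ (cmAbelianVarietyRealised_of_eigenbasis hHD_holds hI_holds h₃) S V c)))).toCore h).side34 (d34Of μ))
        ((((coreOf _ (embOf hHD_holds hI_holds h₁ (cmAbelianVarietyRealised_of_eigenbasis hHD_holds hI_holds h₃)) (coverOf hHD_holds hI_holds h₁ (cmAbelianVarietyRealised_of_eigenbasis hHD_holds hI_holds h₃) hA) (wmOfInput W) (thetaOf _ (thetaClassInputOf _ (fun V c => thetaSpaceInputOf hHD_holds hI_holds h₁ (cmAbelianVarietyRealised_of_eigenbasis hHD_holds hI_holds h₃) S V c)))).toCore h).analyticKM (((coreOf _ (embOf hHD_holds hI_holds h₁ (cmAbelianVarietyRealised_of_eigenbasis hHD_holds hI_holds h₃)) (coverOf hHD_holds hI_holds h₁ (cmAbelianVarietyRealised_of_eigenbasis hHD_holds hI_holds h₃) hA) (wmOfInput W) (thetaOf _ (thetaClassInputOf _ (fun V c => thetaSpaceInputOf hHD_holds hI_holds h₁ (cmAbelianVarietyRealised_of_eigenbasis hHD_holds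 hI_holds h₃) S V c)))).toCore h).side12 (d12Of μ))
          (((coreOf _ (embOf hHD_holds hI_holds h₁ (cmAbelianVarietyRealised_of_eigenbasis hHD_holds hI_holds h₃)) (coverOf hHD_holds hI_holds h₁ (cmAbelianVarietyRealised_of_eigenbasis hHD_holds hI_holds h₃) hA) (wmOfInput W) (thetaOf _ (thetaClassInputOf _ (fun V c => thetaSpaceInputOf hHD_holds hI_holds h₁ (cmAbelianVarietyRealised_of_eigenbasis hHD_holds hI_holds h₃) S V c)))).toCore h).side34 (d34Of μ))).toAnalytic) V c (ℓ := linOfInput W V c)))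
    (hyp34 : ∀ {L : CMField} {ι₁ : L →+* ℂ} (V : HermSpace3 L ι₁) (c : SeesawCtx L),
      (thetaModelOf hHD_holds hI_holds h₁ (cmAbelianVarietyRealised_of_eigenbasis hHD_holds hI_holds h₃) h (embOf hHD_holds hI_holds h₁ (cmAbelianVarietyRealised_of_eigenbasis hHD_holds hI_holds h₃)) (coverOf hHD_holds hI_holds h₁ (cmAbelianVarietyRealised_of_eigenbasis hHD_holds hI_holds h₃) hA) (wmOfInput W) (thetaOf _ (thetaClassInputOf _ (fun V c => thetaSpaceInputOf hHD_holds hI_holds h₁ (cmAbelianVarietyRealised_of_eigenbasis hHD_holds hI_holds h₃) S V c))) (d12Of μ) (d34Of μ)).GoodCtx ι₁ c → Module.finrank ℚ c.K = 6 →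
      Nonempty (((coreOf _ (embOf hHD_holds hI_holds h₁ (cmAbelianVarietyRealised_of_eigenbasis hHD_holds hI_holds h₃)) (coverOf hHD_holds hI_holds h₁ (cmAbelianVarietyRealised_of_eigenbasis hHD_holds hI_holds h₃) hA) (wmOfInput W) (thetaOf _ (thetaClassInputOf _ (fun V c => thetaSpaceInputOf hHD_holds hI_holds h₁ (cmAbelianVarietyRealised_of_eigenbasis hHD_holds hI_holds h₃) S V c)))).toCore h).HypSmoothCore34
        (((coreOf _ (embOf hHD_holds hI_holds h₁ (cmAbelianVarietyRealised_of_eigenbasis hHD_holds hI_holds h₃)) (coverOf hHD_holds hI_holds h₁ (cmAbelianVarietyRealised_of_eigenbasis hHD_holds hI_holds h₃) hA) (wmOfInput W) (thetaOf _ (thetaClassInputOf _ (fun V c => thetaSpaceInputOf hHD_holds hI_holds h₁ (cmAbelianVarietyRealised_of_eigenbasis hHD_holds hI_holds h₃) S V c)))).toCore h).side12 (d12Of μ)) (((coreOf _ (embOf hHD_holds hI_holds h₁ (cmAbelianVarietyRealised_of_eigenbasis hHD_holds hI_holds h₃)) (coverOf hHD_holds hI_holds h₁ (cmAbelianVarietyRealised_of_eigenbasis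 hHD_holds hI_holds h₃) hA) (wmOfInput W) (thetaOf _ (thetaClassInputOf _ (fun V c => thetaSpaceInputOf hHD_holds hI_holds h₁ (cmAbelianVarietyRealised_of_eigenbasis hHD_holds hI_holds h₃) S V c)))).toCore h).side34 (d34Of μ))
        ((((coreOf _ (embOf hHD_holds hI_holds h₁ (cmAbelianVarietyRealised_of_eigenbasis hHD_holds hI_holds h₃)) (coverOf hHD_holds hI_holds h₁ (cmAbelianVarietyRealised_of_eigenbasis hHD_holds hI_holds h₃) hA) (wmOfInput W) (thetaOf _ (thetaClassInputOf _ (fun V c => thetaSpaceInputOf hHD_holds hI_holds h₁ (cmAbelianVarietyRealised_of_eigenbasis hHD_holds hI_holds h₃) S V c)))).toCore h).analyticKM (((coreOf _ (embOf hHD_holds hI_holds h₁ (cmAbelianVarietyRealised_of_eigenbasis hHD_holds hI_holds h₃)) (coverOf hHD_holds hI_holds h₁ (cmAbelianVarietyRealised_of_eigenbasis hHD_holds hI_holds h₃) hA) (wmOfInput W) (thetaOf _ (thetaClassInputOf _ (fun V c => thetaSpaceInputOf hHD_holds hI_holds h₁ (cmAbelianVarietyRealised_of_eigenbasis hHD_holds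 hI_holds h₃) S V c)))).toCore h).side12 (d12Of μ))
          (((coreOf _ (embOf hHD_holds hI_holds h₁ (cmAbelianVarietyRealised_of_eigenbasis hHD_holds hI_holds h₃)) (coverOf hHD_holds hI_holds h₁ (cmAbelianVarietyRealised_of_eigenbasis hHD_holds hI_holds h₃) hA) (wmOfInput W) (thetaOf _ (thetaClassInputOf _ (fun V c => thetaSpaceInputOf hHD_holds hI_holds h₁ (cmAbelianVarietyRealised_of_eigenbasis hHD_holds hI_holds h₃) S V c)))).toCore h).side34 (d34Of μ))).toAnalytic) V c (ℓ := linOfInput W V c))) :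
     (picardCMUniverseK h₁ (cmAbelianVarietyRealised_of_eigenbasis hHD_holds hI_holds h₃)).PerL :=
  perL_picardCM_r19AE hHD_holds hI_holds h₁ h₃ h hA W S μ hR hsmall C hT hpd hk gen12 real34 hyp12 hyp34

end Model

end HodgeCM
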